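import Mathlib
import Summits.Ventures.PercRepro2.Defs
import Summits.Ventures.PercRepro2.Independence
import Summits.Ventures.PercRepro2.Harris
import Summits.Ventures.PercRepro2.Graph
import Summits.Ventures.PercRepro2.Exploration
import Summits.Ventures.PercRepro2.Events
import Summits.Ventures.PercRepro2.Induced
import Summits.Ventures.PercRepro2.BHK
import Summits.Ventures.PercRepro2.BHKEvents
import Summits.Ventures.PercRepro2.OneEdge
import Summits.Ventures.PercRepro2.RBRoot
import Summits.Ventures.PercRepro2.RBRootEdge
import Summits.Ventures.PercRepro2.RBRootEdgePin
import Summits.Ventures.PercRepro2.RBRootEdgeMain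
import Summits.Ventures.PercRepro2.RBRootIsolated
import Summits.Ventures.PercRepro2.RBTwoMarkers
import Summits.Ventures.PercRepro2.RBTwoMarkersMain
import Summits.Ventures.PercRepro2.RBTwoMarkersCross
import Summits.Ventures.PercRepro2.RBTwoMarkersCrossMain
import Summits.Ventures.PercRepro2.RBDefs
import Summits.Ventures.PercRepro2.RBClubDefs
import Summits.Ventures.PercRepro2.RBClubPoly

/-!
# Candidate row 2′RB-CLUB at a third vertex adjacent only to the two markers — the masses
(blind cell PercRepro2, mine-a g8; MINE-A.md §48–§49, proofs/MINEA-CLUB.md §7)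

Let `e₁ = {w, b}`, `e₂ = {w, o}` be the only edges of nonzero weight at `w ∉ {s, t, b, o}`. The
seven masses of the coarse row `RB.Club` are mixtures over the four patterns of `(e₁, e₂)`:
* both closed — `w` is isolated: `{s ↔ w}` is null (`prob_inter_conn_eq_zero_of_closed`);
* `e₁` open, `e₂` closed — `{s ↔ w} = {s ↔ b}` on the support (`prob_update_one_inter_conn_eq`),
  the core events are those of `G − w` (`RBTwoMarkers.prob_leaf_update_events`);
* `e₂` open, `e₁` closed — the mirror image;
* both open — `b ≡ o` through `w` (`RBTwoMarkers.conn_force_two`): `Q` loses the masses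
  `H = P(Q ∩ bL ∩ oH)`, `K = P(Q ∩ oL ∩ bH)`, and `{s ↔ w} = {b ∈ C_s or o ∈ C_s}` has mass
  `A + C − J − H − K` (`prob_both_open_compl`, `prob_both_open_conn`).
The resulting cleared cubic is `RBClubPoly.clubPoly` in the core masses, so
`RBClubPoly.clubPoly_nonneg` (the §48 certificate) and `RBClubPoly.club_of_cleared` give
`club_two_markers_of_zero`; `club_one_marker_of_zero` / `club_isolated` are the one- and
zero-marker cases (`P = π (Z − A) Δ` resp. `P = 0`), and `club_of_markers` packages them.
-/

namespace Summit.Ventures.PercRepro2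

namespace RBClubTwoMarkers

open scoped Classical

section Patterns

variable {V : Type*} {E : Type*} [Fintype E] [DecidableEq E] [Fintype V] {R : Type*} [Field R]
  [LinearOrder R] [IsStrictOrderedRing R] (ends : E → Sym2 V) (s w : V)

omit [Fintype V] [LinearOrder R] [IsStrictOrderedRing R] in
/-- If every edge at `w` has weight `0`, the event `{s ↔ w}` (`s ≠ w`) is null. -/
lemma prob_inter_conn_eq_zero_of_closed (q : E → R) (hz : ∀ e, w ∈ ends e → q e = 0) (hws : s ≠ w)
    (Z : Set (Config E)) : prob q (Z ∩ connEvent ends s w) = 0 := by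
  rw [RBTwoMarkers.prob_inter_closed_of_zero q (fun e => w ∈ ends e) hz]
  have h : Z ∩ connEvent ends s w ∩ {ω : Config E | ∀ e, w ∈ ends e → ω e = false} = ∅ := by
    refine Set.eq_empty_iff_forall_notMem.2 fun ω hω => ?_
    obtain ⟨⟨_, hsw⟩, hcl⟩ := hω
    have hs : s ∈ cluster ends ω w := mem_cluster.2 (conn_symm hsw)
    rw [RBTwoMarkers.cluster_eq_singleton_of_closed ends w hcl] at hs
    exact hws hs
  rw [h, prob_empty]

omit [Fintype V] [LinearOrder R] [IsStrictOrderedRing R] in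
/-- If every edge at `w` has weight `0`, `P(Z ∩ {s ↔ w}ᶜ) = P(Z)` (`s ≠ w`). -/
lemma prob_inter_compl_conn_eq_of_closed (q : E → R) (hz : ∀ e, w ∈ ends e → q e = 0) (hws : s ≠ w)
    (Z : Set (Config E)) : prob q (Z ∩ (connEvent ends s w)ᶜ) = prob q Z := by
  have := prob_inter_add_prob_inter_compl q Z (connEvent ends s w)
  rw [prob_inter_conn_eq_zero_of_closed ends s w q hz hws Z, zero_add] at this
  exact this

omit [Fintype V] [LinearOrder R] [IsStrictOrderedRing R] in
/-- Under `p[e ↦ 1]` with `e = {w, b}`: `P(Z ∩ {s ↔ w} ∩ X) = P(Z ∩ {b ↔ s} ∩ X)`. -/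
lemma prob_update_one_inter_conn_eq (q : E → R) {e : E} {b : V} (hends : ends e = s(w, b))
    (Z X : Set (Config E)) :
    prob (Function.update q e 1) (Z ∩ connEvent ends s w ∩ X) =
      prob (Function.update q e 1) (Z ∩ connEvent ends b s ∩ X) := by
  rw [← prob_update_one_inter_openEdge, ← prob_update_one_inter_openEdge q (Z ∩ connEvent ends b s ∩ X)]
  congr 1
  ext ω
  simp only [Set.mem_inter_iff, mem_connEvent, mem_openEdge]
  constructor
  · rintro ⟨⟨⟨hZ, hsw⟩, hX⟩, he⟩
    exact ⟨⟨⟨hZ, conn_symm (conn_trans hsw (conn_of_openAdj ⟨e, he, hends⟩))⟩, hX⟩, he⟩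
  · rintro ⟨⟨⟨hZ, hbs⟩, hX⟩, he⟩
    exact ⟨⟨⟨hZ, conn_trans (conn_symm hbs) (conn_symm (conn_of_openAdj ⟨e, he, hends⟩))⟩, hX⟩, he⟩

omit [Fintype V] [LinearOrder R] [IsStrictOrderedRing R] in
/-- Under `p[e ↦ 1]` with `e = {w, b}`: `P(Z ∩ {s ↔ w}ᶜ ∩ X) = P(Z ∩ {b ↔ s}ᶜ ∩ X)`. -/
lemma prob_update_one_inter_compl_conn_eq (q : E → R) {e : E} {b : V} (hends : ends e = s(w, b))
    (Z X : Set (Config E)) :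
    prob (Function.update q e 1) (Z ∩ (connEvent ends s w)ᶜ ∩ X) =
      prob (Function.update q e 1) (Z ∩ (connEvent ends b s)ᶜ ∩ X) := by
  rw [← prob_update_one_inter_openEdge,
    ← prob_update_one_inter_openEdge q (Z ∩ (connEvent ends b s)ᶜ ∩ X)]
  congr 1
  ext ω
  simp only [Set.mem_inter_iff, Set.mem_compl_iff, mem_connEvent, mem_openEdge]
  constructor
  · rintro ⟨⟨⟨hZ, hsw⟩, hX⟩, he⟩
    exact ⟨⟨⟨hZ, fun hbs => hsw (conn_trans (conn_symm hbs)
      (conn_symm (conn_of_openAdj ⟨e, he, hends⟩)))⟩, hX⟩, he⟩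
  · rintro ⟨⟨⟨hZ, hbs⟩, hX⟩, he⟩
    exact ⟨⟨⟨hZ, fun hsw => hbs (conn_symm (conn_trans hsw
      (conn_of_openAdj ⟨e, he, hends⟩)))⟩, hX⟩, he⟩

omit [Fintype E] [DecidableEq E] [Fintype V] [LinearOrder R] [IsStrictOrderedRing R] in
/-- Inclusion–exclusion for two complements:
`P(S ∩ Xᶜ ∩ Yᶜ) = P(S) − P(S ∩ X) − P(S ∩ Y) + P(S ∩ X ∩ Y)`. -/
lemma prob_inter_compl_compl [Fintype E] [DecidableEq E] (q : E → R) (S X Y : Set (Config E)) :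
    prob q (S ∩ Xᶜ ∩ Yᶜ) = prob q S - prob q (S ∩ X) - prob q (S ∩ Y) + prob q (S ∩ X ∩ Y) := by
  have h1 := prob_inter_add_prob_inter_compl q S X
  have h2 := prob_inter_add_prob_inter_compl q (S ∩ Xᶜ) Y
  have h3 := prob_inter_add_prob_inter_compl q (S ∩ Y) X
  rw [Set.inter_right_comm S Y X, Set.inter_right_comm S Y Xᶜ] at h3
  calc prob q (S ∩ Xᶜ ∩ Yᶜ) = prob q (S ∩ Xᶜ) - prob q (S ∩ Xᶜ ∩ Y) := by rw [← h2]; ring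
    _ = (prob q S - prob q (S ∩ X)) - (prob q (S ∩ Y) - prob q (S ∩ X ∩ Y)) := by
        rw [← h1, ← h3]; ring
    _ = prob q S - prob q (S ∩ X) - prob q (S ∩ Y) + prob q (S ∩ X ∩ Y) := by ring

omit [Fintype E] [DecidableEq E] [Fintype V] [LinearOrder R] [IsStrictOrderedRing R] in
/-- `{b ↔ s} ∩ {b ↔ t} ⊆ {s ↔ t}`: the two marker types exclude each other under `Q`. -/
lemma compl_inter_conn_inter_conn (t b : V) :
    (connEvent ends s t)ᶜ ∩ connEvent ends b s ∩ connEvent ends b t = ∅ := by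
  refine Set.eq_empty_iff_forall_notMem.2 fun ω hω => ?_
  obtain ⟨⟨hQ, hbs⟩, hbt⟩ := hω
  exact hQ (conn_trans (conn_symm hbs) hbt)

end Patterns

section BothOpen

variable {V : Type*} {E : Type*} [Fintype E] [DecidableEq E] [Fintype V] {R : Type*} [Field R]
  [LinearOrder R] [IsStrictOrderedRing R] (ends : E → Sym2 V) (s t w : V) (p : E → R) {e₁ e₂ : E}
  {b o : V}

omit [Fintype V] [LinearOrder R] [IsStrictOrderedRing R] in
/-- **Both marker edges open, the conditioning event**: with every other edge at `w` of weight
`0`, `P₁₁(Q) = P₀₀(Q ∩ (bL ∩ oH)ᶜ ∩ (oL ∩ bH)ᶜ)` (opening `e₁, e₂` identifies `b ≡ o`). -/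
lemma prob_both_open_compl (hz : ∀ e, w ∈ ends e → e ≠ e₁ → e ≠ e₂ → p e = 0)
    (hends₁ : ends e₁ = s(w, b)) (hends₂ : ends e₂ = s(w, o)) (hne : e₁ ≠ e₂) (hws : s ≠ w)
    (hwt : t ≠ w) (hwo : o ≠ w) :
    prob (Function.update (Function.update p e₂ 1) e₁ 1) (connEvent ends s t)ᶜ =
      prob (Function.update (Function.update p e₂ 0) e₁ 0)
        ((connEvent ends s t)ᶜ ∩ (connEvent ends b s ∩ connEvent ends o t)ᶜ ∩
          (connEvent ends o s ∩ connEvent ends b t)ᶜ) := by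
  have hz00 : ∀ e, w ∈ ends e → Function.update (Function.update p e₂ 0) e₁ 0 e = 0 := by
    intro e he
    by_cases h₁ : e = e₁
    · subst h₁; exact Function.update_self _ _ _
    · rw [Function.update_of_ne h₁]
      by_cases h₂ : e = e₂
      · subst h₂; exact Function.update_self _ _ _
      · rw [Function.update_of_ne h₂]; exact hz e he h₁ h₂
  rw [RBTwoMarkers.prob_both_open_eq p hne,
    RBTwoMarkers.prob_inter_closed_of_zero _ (fun e => w ∈ ends e) hz00,
    RBTwoMarkers.prob_inter_closed_of_zero (Function.update (Function.update p e₂ 0) e₁ 0)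
      (fun e => w ∈ ends e) hz00 ((connEvent ends s t)ᶜ ∩ _ ∩ _)]
  congr 1
  ext ω
  simp only [Set.mem_inter_iff, Set.mem_setOf_eq, Set.mem_compl_iff, mem_connEvent]
  constructor
  · rintro ⟨hQ, hcl⟩
    rw [RBTwoMarkers.conn_force_two ends w hends₁ hends₂ hwo hcl hws hwt] at hQ
    refine ⟨⟨⟨fun h => hQ (Or.inl h), ?_⟩, ?_⟩, hcl⟩
    · rintro ⟨hbs, hot⟩; exact hQ (Or.inr (Or.inl ⟨conn_symm hbs, hot⟩))
    · rintro ⟨hos, hbt⟩; exact hQ (Or.inr (Or.inr ⟨conn_symm hos, hbt⟩))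
  · rintro ⟨⟨⟨hQ, hX⟩, hY⟩, hcl⟩
    refine ⟨?_, hcl⟩
    rw [RBTwoMarkers.conn_force_two ends w hends₁ hends₂ hwo hcl hws hwt]
    rintro (h | ⟨h1, h2⟩ | ⟨h1, h2⟩)
    · exact hQ h
    · exact hX ⟨conn_symm h1, h2⟩
    · exact hY ⟨conn_symm h1, h2⟩

omit [Fintype V] [LinearOrder R] [IsStrictOrderedRing R] in
/-- **Both marker edges open, the marker event**: `P₁₁(Q ∩ bL) = P₀₀(Q ∩ (bL ∩ oH)ᶜ ∩ (oL ∩ bH)ᶜ ∩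
(bL ∪ oL))`. -/
lemma prob_both_open_conn (hz : ∀ e, w ∈ ends e → e ≠ e₁ → e ≠ e₂ → p e = 0)
    (hends₁ : ends e₁ = s(w, b)) (hends₂ : ends e₂ = s(w, o)) (hne : e₁ ≠ e₂) (hws : s ≠ w)
    (hwt : t ≠ w) (hwb : b ≠ w) (hwo : o ≠ w) :
    prob (Function.update (Function.update p e₂ 1) e₁ 1)
        ((connEvent ends s t)ᶜ ∩ connEvent ends b s) =
      prob (Function.update (Function.update p e₂ 0) e₁ 0)
        ((connEvent ends s t)ᶜ ∩ (connEvent ends b s ∩ connEvent ends o t)ᶜ ∩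
          (connEvent ends o s ∩ connEvent ends b t)ᶜ ∩ (connEvent ends b s ∪ connEvent ends o s)) := by
  have hz00 : ∀ e, w ∈ ends e → Function.update (Function.update p e₂ 0) e₁ 0 e = 0 := by
    intro e he
    by_cases h₁ : e = e₁
    · subst h₁; exact Function.update_self _ _ _
    · rw [Function.update_of_ne h₁]
      by_cases h₂ : e = e₂
      · subst h₂; exact Function.update_self _ _ _
      · rw [Function.update_of_ne h₂]; exact hz e he h₁ h₂
  rw [RBTwoMarkers.prob_both_open_eq p hne,
    RBTwoMarkers.prob_inter_closed_of_zero _ (fun e => w ∈ ends e) hz00,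
    RBTwoMarkers.prob_inter_closed_of_zero (Function.update (Function.update p e₂ 0) e₁ 0)
      (fun e => w ∈ ends e) hz00 ((connEvent ends s t)ᶜ ∩ _ ∩ _ ∩ _)]
  congr 1
  ext ω
  simp only [Set.mem_inter_iff, Set.mem_setOf_eq, Set.mem_compl_iff, Set.mem_union, mem_connEvent]
  constructor
  · rintro ⟨⟨hQ, hb⟩, hcl⟩
    rw [RBTwoMarkers.conn_force_two ends w hends₁ hends₂ hwo hcl hws hwt] at hQ
    rw [RBTwoMarkers.conn_force_two ends w hends₁ hends₂ hwo hcl hwb hws] at hb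
    refine ⟨⟨⟨⟨fun h => hQ (Or.inl h), ?_⟩, ?_⟩, ?_⟩, hcl⟩
    · rintro ⟨hbs, hot⟩; exact hQ (Or.inr (Or.inl ⟨conn_symm hbs, hot⟩))
    · rintro ⟨hos, hbt⟩; exact hQ (Or.inr (Or.inr ⟨conn_symm hos, hbt⟩))
    · rcases hb with h | ⟨_, h⟩ | ⟨_, h⟩
      · exact Or.inl h
      · exact Or.inr h
      · exact Or.inl h
  · rintro ⟨⟨⟨⟨hQ, hX⟩, hY⟩, hb⟩, hcl⟩
    refine ⟨⟨?_, ?_⟩, hcl⟩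
    · rw [RBTwoMarkers.conn_force_two ends w hends₁ hends₂ hwo hcl hws hwt]
      rintro (h | ⟨h1, h2⟩ | ⟨h1, h2⟩)
      · exact hQ h
      · exact hX ⟨conn_symm h1, h2⟩
      · exact hY ⟨conn_symm h1, h2⟩
    · rw [RBTwoMarkers.conn_force_two ends w hends₁ hends₂ hwo hcl hwb hws]
      rcases hb with h | h
      · exact Or.inl h
      · exact Or.inr (Or.inl ⟨conn_refl _ _ _, h⟩)

end BothOpen

end RBClubTwoMarkers

end Summit.Ventures.PercRepro2
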